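import Summits.ResolutionOfSingularities.ResolutionOfSingularities.Theorems.FrobeniusClosingSteerWords31AGeomRecut

/-!
# Crux `Steer` (stmt-ResolutionOfSingularities-16345), line `switching-dichotomy` — WORDS 31B: §σ2.29 r43 THE `c = 3` GEOMETRIC RE-CUT, part B (HOIST of the registered skeleton r52 5a09c4c2f84a0135, l.2445–2679, inside `section HeightSplitTwo` with its `variable {K : Type} [Field K]`)

Holder res-L0-w41-lead-1 g6 on res-L0-w41-plan-1 RULING 47 (E1) / 104b; see `…Words01Core` for the hoist protocol (bodies byte for byte;
`[cite: …]` / `[folklore]` tags on CLOSED `def … : Prop` words are written «(ref. …)» / «(folklore)» — GATE NOTE of `…Words02Stubs`;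
cite keys inside `[cite:]` tags normalised to `references.bib` keys where needed, as in `…Words03Phases`).
Nothing here is a statement of the manuscript [claim: Hironaka2017, status: under-review]. OURS (candidates / vocabulary; AI review is
weaker than expert review).
-/

open Summit.ResolutionOfSingularities.ResolutionOfSingularities.Theses.FrobeniusClosing (IsolatedForcedTermination)
open Literature.AlgebraicGeometry.Resolution (IsAbhyankarPlace FGOver exists_ringKrullDim_eq_and_trdeg_eq
  trdeg_eq_trdeg_of_isFractionRing locAtCentre IsQuadraticTransformAlong SubringDominates IsRsopPart
  LocalUniformization3 RelLocalUniformization CossartPiltant2019General)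
open Summit.ResolutionOfSingularities.ResolutionOfSingularities.Theorems.SteerRankThinness
  (HasProperCoarsening concl_of_hasProperCoarsening rankOne_of_not_hasProperCoarsening)
open Summit.ResolutionOfSingularities.ResolutionOfSingularities.Theorems.PfaffLine

set_option linter.dupNamespace false

namespace Summit.ResolutionOfSingularities.ResolutionOfSingularities.Theorems.SwitchingDichotomy.Words

section SteeredTwo

open IsLocalRing
open Literature.AlgebraicGeometry.Resolution (IsLocalBlowupAlong IsQuadraticTransform IsExcellentRing)

variable {K : Type} [Field K]


/-- **(X) NoStrippedThreadTwoN** — the CURRENCY-FREE thread statement the height split actually consumes: under the hypotheses of F-A3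
(a normalised steered run without dominant tail, eventually of high order; an infinite ancestor-chain `J` of centres of height `≥ 2` that is
finitely-hit-two but not finitely hit) — `False`. Produced from (F-A3, hS2, hS3) in either currency (`noStrippedThreadTwoN_of_H`, `…_of_HG`).
OURS. (folklore) -/
def NoStrippedThreadTwoN : Prop :=
  ∀ p : ℕ, p = 2 →
    ∀ (k K : Type) [Field k] [CharP k p] [PerfectField k] [Field K] [Algebra k K]
    (O : ValuationSubring K) (A₀ : Subalgebra k K) (h₀ : A₀.toSubring ≤ O.toSubring) (t : K),
    CoreDatum p 4 k K O A₀ h₀ t → ¬ HasProperCoarsening O →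
    ∀ (R : ℕ → Subring K) (P : (i : ℕ) → Ideal (R i)) (s : ℕ → K),
      R 0 = locAtCentre A₀.toSubring O → NormalAt O (R 0) p t → IsSteeredRun O R P t p s →
      (¬ ∃ i₀ c : ℕ, 1 ≤ c ∧ IsDominantTail R P i₀ c) →
      (∃ i₀ : ℕ, ∀ i, i₀ ≤ i → IsHighOrderAt R s p i) →
      ∀ J : Set ℕ, J.Infinite → (∀ i ∈ J, ∀ j ∈ J, i < j → IsAncestorStep R P i j) →
        (∀ j ∈ J, 2 ≤ (P j).height) → IsFinitelyHitTwo R P J → ¬ IsFinitelyHit R P J →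
        False

/-- (X) ⟸ F-A3 (v2.2) ∧ K♭H(2, 2) ∧ K♭H(2, 3) — the five lines of `highWanderConclTwoN_of_heightSplitH₂` that consume them. Pure logic. OURS. [folklore] -/
theorem noStrippedThreadTwoN_of_H (hA3 : StrippedThreadTwoNH)
    (hS2 : NoEternalStrippedRadicandChainH 2 2) (hS3 : NoEternalStrippedRadicandChainH 2 3) : NoStrippedThreadTwoN := by
  intro p hp2 k K _ _ _ _ _ O A₀ h₀ t core hrk R P s hR0 hN hrun hnd hhigh J hJ hA hJ2 hfin2 hfin
  obtain ⟨c, hc2, hc3, hK⟩ := hA3 p hp2 k K O A₀ h₀ t core hrk R P s hR0 hN hrun hnd hhigh J hJ hA hJ2 hfin2 hfin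
  interval_cases c
  · exact hK (by subst hp2; exact hS2)
  · exact hK (by subst hp2; exact hS3)

/-- (X) ⟸ F-A3′ (W5′) ∧ K♭H(2, 2) ∧ K♭HG(2, 3) — the MIXED currency of record (plan-1 RULINGS 156a / 160b (1)): `c = 2` in the H-currency (fed
on the T-line by `noEternalStrippedRadicandChainH_two_two_of_lipmanNormalised`), `c = 3` geometric (fed by `…HG_two_three_of_geom hGW3`). Pure logic. OURS. [folklore] -/
theorem noStrippedThreadTwoN_of_HG (hA3 : StrippedThreadTwoNHG)
    (hS2 : NoEternalStrippedRadicandChainH 2 2) (hS3 : NoEternalStrippedRadicandChainHG 2 3) : NoStrippedThreadTwoN := by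
  intro p hp2 k K _ _ _ _ _ O A₀ h₀ t core hrk R P s hR0 hN hrun hnd hhigh J hJ hA hJ2 hfin2 hfin
  rcases hA3 p hp2 k K O A₀ h₀ t core hrk R P s hR0 hN hrun hnd hhigh J hJ hA hJ2 hfin2 hfin with h2 | h3
  · exact h2 (by subst hp2; exact hS2)
  · exact h3 (by subst hp2; exact hS3)

/-- **THE HEIGHT SPLIT, currency-free** — `highWanderConclTwoN_of_heightSplitH₂` VERBATIM, statement and proof, except that
`(hA3, hS2, hS3)` ↦ `(hX : NoStrippedThreadTwoN)` and the five-line block consuming them ↦ `exact hX …`. PROVED. OURS. [folklore] -/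
theorem highWanderConclTwoN_of_heightSplitX (hS : StrippingTailHighConclTwoN) (hB₂ : BirthWanderHighConclTwoN)
    (hC₂ : BranchWanderHighConclTwoN) (hX : NoStrippedThreadTwoN) (hTi : FinitelyHitThreadTwoN) (hH : HitHeightLtTwoN)
    (hK1 : ∀ p : ℕ, p.Prime → NoEternalIsolatedRadicandChain p 1)
    (hK2 : ∀ p : ℕ, p.Prime → NoEternalIsolatedRadicandChain p 2)
    (hK3 : ∀ p : ℕ, p.Prime → NoEternalIsolatedRadicandChain p 3) : HighWanderConclTwoN := by
  intro p hp2 k K _i1 _i2 _i3 _i4 _i5 O A₀ h₀ t core hrk R P s hR0 hN hrun hnd hio hhigh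
  have hp : p.Prime := hp2 ▸ Nat.prime_two
  -- infinitely many positive steps
  have hinf : {j | IsPosStep R P j}.Infinite := by
    refine Set.infinite_of_not_bddAbove ?_
    rintro ⟨b, hb'⟩
    obtain ⟨i, hi, hnp⟩ := hio (b + 1)
    obtain ⟨hl, -⟩ := hrun.2 i
    have := hb' (show i ∈ {j | IsPosStep R P j} from ⟨hl, fun h => hnp ⟨hl, h⟩⟩)
    omega
  by_cases h2 : HeightTwoStepsInfinite R P
  swap
  · exact hS p hp2 k K O A₀ h₀ t core hrk R P s hR0 hN hrun hnd hhigh h2 hinf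
  by_cases hb : {j | IsRootStep R P j ∧ 2 ≤ (P j).height}.Infinite
  · exact hB₂ p hp2 k K O A₀ h₀ t core hrk R P s hR0 hN hrun hnd hhigh hb
  by_cases hc : ∃ i, 2 ≤ (P i).height ∧ {j | IsChildStep R P i j}.Infinite
  · exact hC₂ p hp2 k K O A₀ h₀ t core hrk R P s hR0 hN hrun hnd hhigh hc
  exfalso
  have hroots : {j | IsRootStep R P j ∧ 2 ≤ (P j).height}.Finite := Set.not_infinite.mp hb
  have hbr : ∀ i, 2 ≤ (P i).height → {j | IsChildStep R P i j}.Finite := fun i hi =>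
    Set.not_infinite.mp fun h => hc ⟨i, hi, h⟩
  have hmono : Monotone R := hrun.monotone
  obtain ⟨hle3, hhit⟩ := hH p hp2 k K O A₀ h₀ t core hrk R P s hR0 hN hrun
  -- descent on the height `h ≥ 2` carrying infinitely many positive steps
  have main : ∀ h : ℕ, 2 ≤ h → {j | IsPosStep R P j ∧ (P j).height = (h : ℕ∞)}.Infinite → False := by
    intro h
    induction h using Nat.strong_induction_on with
    | _ h ih =>
      intro h2le hinfh
      have h2le' : (2 : ℕ∞) ≤ (h : ℕ∞) := by exact_mod_cast h2le
      -- localised graded König at height `h`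
      obtain ⟨J, hJ, hA, hh⟩ := wanderForestKoenig_graded' R P hmono h hinfh
        (hroots.subset fun j hj => ⟨hj.1, by rw [Set.mem_setOf_eq] at hj; rw [hj.2]; exact h2le'⟩)
        (fun i hi => hbr i (by rw [hi]; exact h2le'))
      have hJ2 : ∀ j ∈ J, 2 ≤ (P j).height := fun j hj => by rw [hh j hj]; exact h2le'
      by_cases hfin : IsFinitelyHit R P J
      · obtain ⟨c, hc1, hc3, hK⟩ := hTi p hp2 k K O A₀ h₀ t core hrk R P s hR0 hN hrun J hJ hA hfin
        interval_cases c
        · exact hK (hK1 p hp)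
        · exact hK (hK2 p hp)
        · exact hK (hK3 p hp)
      by_cases hfin2 : IsFinitelyHitTwo R P J
      · exact hX p hp2 k K O A₀ h₀ t core hrk R P s hR0 hN hrun hnd hhigh J hJ hA hJ2 hfin2 hfin
      -- infinitely many hits of height `≥ 2`: positive steps of height in `[2, h)`
      obtain ⟨j₀, hj₀⟩ := hJ.nonempty
      have hH' : {m | IsPosStep R P m ∧ 2 ≤ (P m).height ∧ (P m).height < (h : ℕ∞)}.Infinite := by
        refine Set.infinite_of_not_bddAbove ?_
        rintro ⟨b, hb⟩
        apply hfin2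
        refine ⟨max b j₀ + 1, fun m hm _ j hj hmj => ?_⟩
        have hj₀m : j₀ < m := by omega
        have hA₀ : IsAncestorStep R P j₀ j := hA j₀ hj₀ j hj (lt_trans hj₀m hmj.1.1)
        obtain ⟨hpos, hlt⟩ := hhit j₀ m j hA₀ hj₀m hmj.1
        have hmb : m ≤ b := hb ⟨hpos, hmj.2, lt_of_lt_of_eq hlt (hh j hj)⟩
        omega
      obtain ⟨h', hh'n, hinf'⟩ :=
        exists_fibre_infinite_of_lt (fun m => (P m).height) h hH' fun m hm => hm.2.2
      obtain ⟨m₁, hm₁⟩ := hinf'.nonempty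
      have h2' : 2 ≤ h' := by
        have h1 : (2 : ℕ∞) ≤ (h' : ℕ∞) := by
          have h3 := hm₁.1.2.1
          rw [show (P m₁).height = (h' : ℕ∞) from hm₁.2] at h3
          exact h3
        exact_mod_cast h1
      exact ih h' hh'n h2' (hinf'.mono fun m hm => ⟨hm.1.1, hm.2⟩)
  -- start of the descent: pigeonhole on the positive steps of height `≥ 2` (heights `≤ 3 < 4`, Θ2 (a))
  obtain ⟨h₀, -, hinf₀⟩ := exists_fibre_infinite_of_lt (fun m => (P m).height) 4 h2 fun m hm =>
    lt_of_le_of_lt (hle3 m hm.1) (by exact_mod_cast (by norm_num : (3 : ℕ) < 4))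
  obtain ⟨m₁, hm₁⟩ := hinf₀.nonempty
  have h2₀ : 2 ≤ h₀ := by
    have h1 : (2 : ℕ∞) ≤ (h₀ : ℕ∞) := by
      have h3 := hm₁.1.2
      rw [show (P m₁).height = (h₀ : ℕ∞) from hm₁.2] at h3
      exact h3
    exact_mod_cast h1
  exact main h₀ h2₀ (hinf₀.mono fun m hm => ⟨hm.1.1, hm.2⟩)

/-- Debts form, currency-free. Pure logic. OURS. [folklore] -/
theorem highWanderConclTwoN_of_heightSplit_debtsX (hS : StrippingTailHighConclTwoN) (hB₂ : BirthWanderHighConclTwoN)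
    (hC₂ : BranchWanderHighConclTwoN) (hX : NoStrippedThreadTwoN) (hTi : FinitelyHitThreadTwoN) (hH : HitHeightLtTwoN)
    (hL : Literature.AlgebraicGeometry.Resolution.Lipman1978NoEternalNormalBranch.{0})
    (hCP' : Literature.AlgebraicGeometry.Resolution.CossartPiltant2019LocalPermissible.{0}) : HighWanderConclTwoN :=
  highWanderConclTwoN_of_heightSplitX hS hB₂ hC₂ hX hTi hH noEternalIsolatedRadicandChain_one_holds
    (noEternalIsolatedRadicandChain_two_of_lipman hL) (noEternalIsolatedRadicandChain_three_of_CP' hCP')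

/-- `eternalSteeredRunTwo_of_slate2H₂` currency-free: `(hA3, hS2, hS3)` ↦ `hX`. Pure logic. OURS. [folklore] -/
theorem eternalSteeredRunTwo_of_slate2X (hN1 : NormalAtGeneratorTwo) (hB4 : NoHeightOneCarrierTwo)
    (hTi : FinitelyHitThreadTwoN) (hH : HitHeightLtTwoN)
    (hS : StrippingTailHighConclTwoN) (hB₂ : BirthWanderHighConclTwoN) (hC₂ : BranchWanderHighConclTwoN)
    (hX : NoStrippedThreadTwoN)
    (hLow : Literature.AlgebraicGeometry.Resolution.Lipman1978ValuativeQuadraticSequence.{0} → LowOrderTailConclTwoN)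
    (hL : Literature.AlgebraicGeometry.Resolution.Lipman1978NoEternalNormalBranch.{0})
    (hLV : Literature.AlgebraicGeometry.Resolution.Lipman1978ValuativeQuadraticSequence.{0})
    (hCP' : Literature.AlgebraicGeometry.Resolution.CossartPiltant2019LocalPermissible.{0}) : EternalSteeredRunTwo :=
  eternalSteeredRunTwo_of_normalised_split_debts (normalisedStartTwo_of_normalAtGenerator hN1)
    (pointTailHighConclTwo_of_B4 hB4)
    (highWanderConclTwoN_of_heightSplit_debtsX hS hB₂ hC₂ hX hTi hH hL hCP') (hLow hLV) hL
    (_root_.Summit.ResolutionOfSingularities.ResolutionOfSingularities.Theorems.SwitchingDichotomy.HironakaLUBranchOfCP.hironakaLUIsolatedBranch_of_localPermissible hCP')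

/- DROPPED at hoist time (gate `dedup.landed`): the consistency theorem `eternalSteeredRunTwo_of_slate2H₂_via_X` (same STATEMENT as
`eternalSteeredRunTwo_of_slate2H₂` in `…Words26SigmaResidualPar`, re-derived through (X)); the landed theorem is the one to cite. -/

/-- **T-LINE CANDIDATE slate13 (r42; plan-1 RULINGS 144 (iii) / 146a (ρ₀) / 147a; the holder / plan-1 decide)** = slate12⁗'s named leaves with
the `c = 3` GEOMETRIC RE-CUT `(hG3, hW3) ↦ hGW3` (via (X) and the geometric K♭ currency; F-A3-geom `hA3` an explicit WORK binder until
res-D-pv-003's 144 (iii) engine theorem feeds it by name) and (ρ₀) `hB₂ʰ`, `hC₂ʰ` NATIVE: 11 binders = FRONTIER {hB₂ʰ `BirthWanderHighConclTwoN`,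
hC₂ʰ `BranchWanderHighConclTwoN`, hK4′, hEv, hNS, hGW3 `G-geom(3, 2e)`} · WORK {hNT4, hARᵒ, hA3 `StrippedThreadTwoNHG`} · FACTS {hL′, hCP′};
↦ 10 at r43. No rung, no node. Pure logic. OURS. [folklore] -/
theorem eternalSteeredRunTwo_of_slate13
    (hNT4 : ∀ e : ℕ, 2 ≤ e → NoTangentialStepPerfect 2 4 (2 * e))
    (hNS : NoCompanionSingularSurfaceTwoN) (hARo : StrippingTailSwitchingOddArithTwoN)
    (hK4' : NoCompanionSingularSurfaceTwoN → StrippingTailSwitchingArithConclTwoN) (hEv : StrippingTailSwitchingEvenConclTwoN)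
    (hB₂ : BirthWanderHighConclTwoN) (hC₂ : BranchWanderHighConclTwoN)
    (hGW3 : ∀ e : ℕ, 2 ≤ e → NoEternalConstOrderIsolatedChainGeom 2 3 (2 * e))
    (hA3 : StrippedThreadTwoNHG)
    (hL' : Literature.AlgebraicGeometry.Resolution.Lipman1978NoEternalNormalisedBranch.{0})
    (hCP' : Literature.AlgebraicGeometry.Resolution.CossartPiltant2019LocalPermissible.{0}) : EternalSteeredRunTwo :=
  eternalSteeredRunTwo_of_slate2X normalAtGeneratorTwo_holds noHeightOneCarrierTwo_holds finitelyHitThreadTwoN_holds hitHeightLtTwoN_holds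
    (strippingTailHighConclTwoN_of_persist_pieces pointStepsRecurTwoN_holds pointTailPersistTwoN_holds hNT4
      (strippingTailSwitchingConclTwoN_of_parity' hNS hARo hK4' hEv))
    hB₂ hC₂
    (noStrippedThreadTwoN_of_HG hA3 (noEternalStrippedRadicandChainH_two_two_of_lipmanNormalised hL')
      (noEternalStrippedRadicandChainHG_two_three_of_geom hGW3))
    (lowOrderTailConclTwoN_of_lipman lowOrderStep_holds
      (lowRunTamedMixedBranchTwo_of_pieces' lowSurfaceStepExitsTwo_holds lowTowerExistsTwo_holds lowTowerPointStepsIOTwo_holds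
        lowTowerTamingTwo_holds lowTowerSingularTwo_holds)
      tamedMixedBranchReduction_holds)
    hL'.toNormalBranch hL'.toValuativeQuadraticSequence hCP'

/-- **(ρ₀) compatibility**: the TORIC words of r41 remain SUFFICIENT producers of slate13's `hB₂ʰ`, `hC₂ʰ` (`…_of_toric`, r36 §σ2.27), and the r41
pair (hG3, hW3) feeds `hGW3` (`…Geom_of_pieces`) — so slate13 specialises to r41's binder set modulo the one new WORK binder `hA3`.
Pure logic. OURS. [folklore] -/
theorem eternalSteeredRunTwo_of_slate13_toric
    (hNT4 : ∀ e : ℕ, 2 ≤ e → NoTangentialStepPerfect 2 4 (2 * e))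
    (hNS : NoCompanionSingularSurfaceTwoN) (hARo : StrippingTailSwitchingOddArithTwoN)
    (hK4' : NoCompanionSingularSurfaceTwoN → StrippingTailSwitchingArithConclTwoN) (hEv : StrippingTailSwitchingEvenConclTwoN)
    (hB₂ : BirthWanderToricTwoN) (hC₂ : BranchWanderToricTwoN)
    (hG3 : ∀ e : ℕ, 2 ≤ e → NoEternalConstOrderIsolatedChainPerfect 2 3 (2 * e))
    (hW3 : ∀ e : ℕ, 2 ≤ e → NoEternalConstOrderIsolatedChainImperfect 2 3 (2 * e))
    (hA3 : StrippedThreadTwoNHG)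
    (hL' : Literature.AlgebraicGeometry.Resolution.Lipman1978NoEternalNormalisedBranch.{0})
    (hCP' : Literature.AlgebraicGeometry.Resolution.CossartPiltant2019LocalPermissible.{0}) : EternalSteeredRunTwo :=
  eternalSteeredRunTwo_of_slate13 hNT4 hNS hARo hK4' hEv (birthWanderHighConclTwoN_of_toric hB₂) (branchWanderHighConclTwoN_of_toric hC₂)
    (fun e he => noEternalConstOrderIsolatedChainGeom_of_pieces (hG3 e he) (hW3 e he)) hA3 hL' hCP'

/-- **hGW3 ⟸ hW3 ALONE modulo (K-rank)** on the T-line: slate13 with `hGW3` fed by W(3, 2e) and the kernel fact `GeomChartResidueImperfect 2`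
(RULING 149b (i)) — `hG3` is OFF the line (§17.1; tri-2 v19 (1)). Pure logic. OURS. [folklore] -/
theorem eternalSteeredRunTwo_of_slate13_W
    (hNT4 : ∀ e : ℕ, 2 ≤ e → NoTangentialStepPerfect 2 4 (2 * e))
    (hNS : NoCompanionSingularSurfaceTwoN) (hARo : StrippingTailSwitchingOddArithTwoN)
    (hK4' : NoCompanionSingularSurfaceTwoN → StrippingTailSwitchingArithConclTwoN) (hEv : StrippingTailSwitchingEvenConclTwoN)
    (hB₂ : BirthWanderHighConclTwoN) (hC₂ : BranchWanderHighConclTwoN)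
    (hKr : GeomChartResidueImperfect 2)
    (hW3 : ∀ e : ℕ, 2 ≤ e → NoEternalConstOrderIsolatedChainImperfect 2 3 (2 * e))
    (hA3 : StrippedThreadTwoNHG)
    (hL' : Literature.AlgebraicGeometry.Resolution.Lipman1978NoEternalNormalisedBranch.{0})
    (hCP' : Literature.AlgebraicGeometry.Resolution.CossartPiltant2019LocalPermissible.{0}) : EternalSteeredRunTwo :=
  eternalSteeredRunTwo_of_slate13 hNT4 hNS hARo hK4' hEv hB₂ hC₂
    (fun e he => noEternalConstOrderIsolatedChainGeom_of_W hKr Nat.prime_two (hW3 e he)) hA3 hL' hCP'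


/-! #### §σ2.30 r44 — hA3 CLOSED IN THE KERNEL · hNS OFF THE T-LINE · THE K4♯ COMPANION SPLIT · hKr BY NAME
(plan-1 RULING 160 (g10); ONE delta by res-L0-w41-strat-2 g3 against r43 `acbbcc299fb3f591`; the leaf is res-D-pv-003's; tri-2 splice-audits;
the holder registers — nothing registered changes)

(160a) hNS `NoCompanionSingularSurfaceTwoN` is REFUTED-SUBSTANTIVE as a T-line binder, OF RECORD (res-L0-w41-strat-1's bench M
`t² = z⁵ + x⁶y⁴z + z²u³ + u⁵` over `𝔽₂`, HNS-CYCLE 7e76732e5b429558; tri-2 TRIAGE v22 4df48ec681a11c9d «refutation stands»): an ETERNAL σ_top-legal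
(Par-S) run with a non-regular companion singular surface through the centre at EVERY A-stage (`d = 5`), while `Concl(M)` HOLDS by a closed-form
chart (strat-1 SHARP-GAME-M 663a9f36e2bfa179) — the companion obstructs σ_top, not local uniformization. (160b) THE r44 OBJECT, in this block:
* (2) **hA3 CLOSED**: res-D-pv-003's LEAF `strippedThreadTwoNHG_of_L7` / `strippedThreadTwoNHG_holds : StrippedThreadTwoNHG` over the FILED
  F-A3-geom engine `StrippedThread.exists_not_noEternalStrippedChainHG_of_infinitelyHit` (p539326 ✓) + `GeoDict.exists_geomDatum_of_locChar_coheight_one`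
  (p538711 ✓) + res-D-pv-004's (L7) — against the (W5′) word (edit (1), made in place above: `c = 2 ↦ ¬ K♭H`, `c = 3 ↦ ¬ K♭HG`);
* (4) **hNS RE-GLUE**: (h0) `strippingTailSwitchingConclTwoN_of_parityK` — the parity glue WITHOUT hNS (PROVED); (h1) hK4ⁿᶜ
  `StrippingTailSwitchingArithNoCompanionConclTwoN`, (h2) hK4ᶜ `StrippingTailSwitchingArithCompanionConclTwoN` — K4♯'s binders VERBATIM + hNS's
  companion vocabulary VERBATIM as the case predicate (eventually-none / infinitely-often); (h3) `strippingTailSwitchingArithConclTwoN_of_companionSplit`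
  K4♯ ⟸ hK4ⁿᶜ ∧ hK4ᶜ (PROVED, the per-tail dichotomy); (h4) both sub-cases ⟸ K4♯ and `hK4'_of_noCompanionConcl : hK4ⁿᶜ → (hNS → K4♯)` (PROVED
  one-liners — slate13's hK4′ is fed by the β-leaf's new target: nothing of record lost);
* (5) **hKr BY NAME**: (h5) `geomChartResidueImperfect_two : GeomChartResidueImperfect 2` from res-L0-w41-stub-3's `GeomChain.geomChartResidueImperfect_holds`
  (p538090 ✓; (W3) with `IsGeomChart` unfolded ⇒ `δ`);
* **T-LINE**: spine `eternalSteeredRunTwo_of_slate14X` (7 binders hNT4 · hSw `(Par-S)` · hB₂ʰ · hC₂ʰ · hX `NoStrippedThreadTwoN` · hL′ · hCP′ — every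
  later splice (hEv leaf ⇒ hSw's feeder, β-leaf ⇒ hK4ⁿᶜ) is a one-line feeder); **candidate of record `eternalSteeredRunTwo_of_slate14`, 10 binders
  hNT4 · hARᵒ · hK4ⁿᶜ · hK4ᶜ · hEv · hB₂ʰ · hC₂ʰ · hGW3 · hL′ · hCP′** (RULING 160b (4); hA3 fed by `strippedThreadTwoNHG_holds`, (3)); feeders
  `…slate14_K` (K4♯ STRONG in place of the pair: 9 binders) and `…slate14_W` (hW3 ALONE in hGW3's slot via (h5): 10 binders).
slate13 (statement) and everything above the block stay theorems; the only in-place edits are the four (W5′) lines of (1). -/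


end SteeredTwo

end Summit.ResolutionOfSingularities.ResolutionOfSingularities.Theorems.SwitchingDichotomy.Words
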